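import Literature.NumberTheory.QuadraticFields.DedekindZetaReducedForms
import Literature.NumberTheory.QuadraticFields.QuadraticDedekindZetaOddPrimitive
import Literature.NumberTheory.QuadraticFields.EpsteinZetaKroneckerLimitExact
import Literature.NumberTheory.LFunctions.LerchFormula
import Literature.NumberTheory.LFunctions.OddCharLogDerivFE
import Literature.NumberTheory.QuadraticFields.JacobiCharacterPrimitiveProofs
import Literature.NumberTheory.QuadraticFields.ChowlaSelbergFifteenSum
import Literature.NumberTheory.Transcendental.GammaMonomialsLValue
import Mathlib.NumberTheory.Harmonic.ZetaAsymp
import Mathlib.Tactic.NormNum.LegendreSymbol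
import HarnessLib

/-!
# The Chowla–Selberg formula (logarithmic form) for imaginary quadratic discriminants `−d < −4`

Topic `NumberTheory/QuadraticFields`. THEOREMS (everything proved; no definitions, no named facts).

Let `χ` be a primitive quadratic odd Dirichlet character mod `d` with `d > 4` (so `−d` is a
fundamental discriminant `< −4`, `w = 2`), let `h = h(−d)` be the number of reduced primitive
positive definite forms `Q = (a, b, c)` of discriminant `−d`
(`Literature.NumberTheory.QuadraticFields.BinaryQuadraticForm.reducedForms`), and
`τ_Q = (b + i√d)/(2a)` (`KroneckerLimit.rootPoint`). Then (**Chowla–Selberg**, [SelbergChowla1967,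
§2, (2)–(3)] in the form obtained by summing Kronecker's limit formula over the classes)

  `Σ_{Q ∈ reducedForms(−d)} (4 log|η(τ_Q)| + log(d/a_Q)) = h · (Σ_{k=1}^{d−1} χ(k) log Γ(k/d)) / L(0, χ) − h log(2π)`

(`chowlaSelberg_log`), i.e. `∏_Q (d/a_Q)|η(τ_Q)|⁴ = (2π)^{−h} ∏_k Γ(k/d)^{h χ(k)/L(0,χ)}` with
`L(0, χ) = −(1/d) Σ k χ(k)` (`= 2h/w = h` classically). On the way:

* `sum_epsteinZeta_eq` — `Σ_{Q} Z_Q(s) = 2 ζ(s) L(s, χ)` (`Re s > 1`): the tree's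
  `Quadratic.dedekindZeta_eq_half_sum_epsteinZeta` (`ζ_K = ½ Σ_Q Z_Q`) and
  `Quadratic.dedekindZeta_eq_riemannZeta_mul_LFunction_of_odd_primitive` (`ζ_K = ζ · L(χ)`) for the
  quadratic field `K` with `d_K = −d` (`Quadratic.exists_quadraticField_of_odd_primitive`);
* `tendsto_sum_epsteinZeta_sub` — Kronecker's first limit formula
  (`KroneckerLimit.tendsto_epsteinZeta_sub_pole_eta`) summed over the reduced forms;
* `two_mul_LFunction_one_eq` — **Dirichlet's class number formula** `2 L(1, χ) = h · 2π/√d`,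
  re-derived by comparing poles, and `two_mul_deriv_LFunction_one_eq` — **Kronecker's evaluation of
  `L'(1, χ)`**: `2 L'(1, χ) = (2π/√d)(γ h − Σ_Q (log(d/a_Q) + 4 log|η(τ_Q)|))`, by comparing constant
  terms (Mathlib's `tendsto_riemannZeta_sub_one_div`: `ζ(s) − 1/(s−1) → γ`);
* the passage to `s = 0` is the tree's `OddCharLogDeriv.logDeriv_LFunction_zero_add_one`
  (functional equation) and Lerch's formula `Lerch.deriv_LFunction_zero_of_ne_one`
  (`L'(0, χ) = −(log d) L(0, χ) + Σ χ(k) log Γ(k/d)`).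

This is the `η`-evaluation input ([sc67] of Borwein–Straub–Wan–Zudilin) of
`Literature.Analysis.FunctionSpaces.BorweinStraubWanZudilin2012_thm9`; the case `d = 15` is made
explicit in `chowlaSelberg_log_fifteen` and, exponentiated,
`chowlaSelberg_fifteen_prod`: `Γ(1/15)Γ(2/15)Γ(4/15)Γ(8/15)/(Γ(7/15)Γ(11/15)Γ(13/15)Γ(14/15)) = 450π²|η(τ₁)|⁴|η(τ₂)|⁴` (the companion file `ChowlaSelbergFifteenSum.lean` of the
tree treats the `d = 15` sum half directly: `Z₁ + Z₂ = 2ζL`, `C₁ + C₂ = 2(γL(1,χ) + L′(1,χ))`; here the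
general `d` is done and the passage to `log Γ` is completed).

## References

* [SelbergChowla1967] A. Selberg, S. Chowla, On Epstein's zeta-function, J. reine angew. Math.
  227 (1967), 86–110, §2.
* C. L. Siegel, *Advanced Analytic Number Theory*, Tata Institute (1961/1980), Ch. I §§1–2
  (Kronecker's limit formula), Ch. II §1 (application to `L(1, χ)`).
* D. B. Zagier, *Zetafunktionen und quadratische Körper* (1981), §8.
-/

noncomputable section

open Complex Filter Topology Finset
open scoped Real

open Literature.Barriers.RiemannHypothesis (epsteinZeta IsPosDefForm)
open Literature.NumberTheory.QuadraticFields.BinaryQuadraticForm (reducedForms mem_reducedForms_iff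
  discr_apply IsReduced)
open Literature.NumberTheory.QuadraticFields.KroneckerLimit (rootPoint tendsto_epsteinZeta_sub_pole_eta)
open Literature.NumberTheory.QuadraticFields.Quadratic (dedekindZeta_eq_half_sum_epsteinZeta
  dedekindZeta_eq_riemannZeta_mul_LFunction_of_odd_primitive exists_quadraticField_of_odd_primitive
  tendsto_ofReal_nhdsGT_one)
open Literature.NumberTheory.LFunctions (Lerch.deriv_LFunction_zero_of_ne_one
  Lerch.sum_univ_zmod_eq_sum_range OddCharLogDeriv.logDeriv_LFunction_zero_add_one
  OddCharLogDeriv.LFunction_apply_zero_ne_zero OddCharLogDeriv.ne_one_of_odd)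
open Literature.NumberTheory.QuadraticFields (jacobiChar jacobiChar_natCast isPrimitive_jacobiChar
  isQuadratic_jacobiChar jacobiChar_neg_one_of_mod_four_eq_three)
open Literature.NumberTheory.Transcendental (KoblitzOgus.LFunction_apply_zero_of_odd)
open Literature.NumberTheory.QuadraticFields.ChowlaSelbergFifteen (reducedForms_neg_fifteen)
open scoped NumberTheorySymbols

namespace Literature.NumberTheory.QuadraticFields.ChowlaSelberg

/-! ### The reduced forms of discriminant `−d` are positive definite with `4ac − b² = d` -/

/-- A member `(a, b, c)` of `reducedForms (−d)` (`d > 0`) has `a > 0` and `4ac − b² = d` (as real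
numbers), hence is positive definite. [folklore] -/
theorem four_mul_sub_sq_eq_of_mem {d : ℕ} (hd : 0 < d) {Q : ℤ × ℤ × ℤ}
    (hQ : Q ∈ reducedForms (-(d : ℤ))) :
    0 < (Q.1 : ℝ) ∧ 4 * (Q.1 : ℝ) * Q.2.2 - (Q.2.1 : ℝ) ^ 2 = d := by
  have hD : (-(d : ℤ)) < 0 := by omega
  obtain ⟨hdisc, ha, -, -⟩ := (mem_reducedForms_iff hD).1 hQ
  obtain ⟨a, b, c⟩ := Q
  rw [discr_apply] at hdisc
  refine ⟨by exact_mod_cast ha, ?_⟩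
  have h : (4 * a * c - b ^ 2 : ℤ) = d := by linarith
  exact_mod_cast h

/-- Positive definiteness of the members of `reducedForms (−d)`. [folklore] -/
theorem isPosDefForm_of_mem {d : ℕ} (hd : 0 < d) {Q : ℤ × ℤ × ℤ}
    (hQ : Q ∈ reducedForms (-(d : ℤ))) : IsPosDefForm (Q.1 : ℝ) (Q.2.1 : ℝ) (Q.2.2 : ℝ) := by
  obtain ⟨ha, h⟩ := four_mul_sub_sq_eq_of_mem hd hQ
  have hd' : (0 : ℝ) < d := by exact_mod_cast hd
  exact ⟨ha, by linarith⟩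

/-! ### `Σ_Q Z_Q(s) = 2 ζ(s) L(s, χ)` -/

/-- **Dirichlet's decomposition**: for a primitive quadratic odd character `χ` mod `d > 4` and
`Re s > 1`, `Σ_{Q ∈ reducedForms(−d)} Z_Q(s) = 2 ζ(s) L(s, χ)` (both sides are `2 ζ_K(s)` for the
quadratic field `K` with `d_K = −d`). [cite: SelbergChowla1967, §2] -/
theorem sum_epsteinZeta_eq {d : ℕ} [NeZero d] {χ : DirichletCharacter ℂ d} (hprim : χ.IsPrimitive)
    (hquad : χ.IsQuadratic) (hodd : χ.Odd) (hd4 : 4 < d) {s : ℂ} (hs : 1 < s.re) :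
    ∑ Q ∈ reducedForms (-(d : ℤ)), epsteinZeta (Q.1 : ℝ) (Q.2.1 : ℝ) (Q.2.2 : ℝ) s =
      2 * riemannZeta s * χ.LFunction s := by
  obtain ⟨K, hF, hNF, h2, hdisc⟩ := exists_quadraticField_of_odd_primitive hprim hquad hodd
  have hlt : NumberField.discr K < -4 := by rw [hdisc]; omega
  have h1 := dedekindZeta_eq_half_sum_epsteinZeta h2 hlt hs
  have h2' := dedekindZeta_eq_riemannZeta_mul_LFunction_of_odd_primitive hprim hquad hodd h2 hdisc hs
  rw [hdisc] at h1
  rw [h1] at h2'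
  linear_combination 2 * h2'

/-! ### Kronecker's limit formula summed over the classes -/

/-- **Summed Kronecker limit formula**: with `h = #reducedForms(−d)` and `τ_Q = rootPoint a b c`,
`Σ_Q Z_Q(s) − h (2π/√d)/(s − 1) → (2π/√d) Σ_Q (2γ − log(d/a_Q) − 4 log|η(τ_Q)|)` as `s → 1⁺`.
[folklore] -/
theorem tendsto_sum_epsteinZeta_sub {d : ℕ} (hd : 0 < d) :
    Tendsto (fun s : ℝ => ∑ Q ∈ reducedForms (-(d : ℤ)),
        epsteinZeta (Q.1 : ℝ) (Q.2.1 : ℝ) (Q.2.2 : ℝ) s -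
          ((reducedForms (-(d : ℤ))).card : ℂ) * ((2 * π / Real.sqrt d : ℝ) : ℂ) / ((s : ℂ) - 1))
      (𝓝[>] 1)
      (𝓝 (∑ Q ∈ reducedForms (-(d : ℤ)), ((2 * π / Real.sqrt d *
          (2 * Real.eulerMascheroniConstant - Real.log ((d : ℝ) / Q.1) -
            4 * Real.log ‖ModularForm.eta (rootPoint (Q.1 : ℝ) (Q.2.1 : ℝ) (Q.2.2 : ℝ))‖) : ℝ) :
              ℂ))) := by
  have hsum := tendsto_finsetSum (reducedForms (-(d : ℤ)))
    (fun Q (hQ : Q ∈ reducedForms (-(d : ℤ))) => by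
      have h := tendsto_epsteinZeta_sub_pole_eta (isPosDefForm_of_mem hd hQ)
      rw [(four_mul_sub_sq_eq_of_mem hd hQ).2] at h
      exact h)
  refine hsum.congr fun s => ?_
  rw [Finset.sum_sub_distrib, Finset.sum_const, nsmul_eq_mul]
  ring

/-! ### Comparing the two expansions at `s = 1` -/

/-- If `C/(s − 1) → L` (finite) as `s → 1⁺` then `C = 0`. [folklore] -/
theorem eq_zero_of_tendsto_div_sub_one {C L : ℂ}
    (h : Tendsto (fun s : ℝ => C / ((s : ℂ) - 1)) (𝓝[>] 1) (𝓝 L)) : C = 0 := by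
  have h0 : Tendsto (fun s : ℝ => ((s : ℂ) - 1)) (𝓝[>] 1) (𝓝 0) := by
    have h1 : Tendsto (fun s : ℝ => ((s : ℂ) - 1)) (𝓝 1) (𝓝 (((1 : ℝ) : ℂ) - 1)) :=
      ((Complex.continuous_ofReal.tendsto (1 : ℝ)).sub tendsto_const_nhds)
    rw [ofReal_one, sub_self] at h1
    exact h1.mono_left nhdsWithin_le_nhds
  have hprod := h.mul h0
  rw [mul_zero] at hprod
  have heq : (fun s : ℝ => C / ((s : ℂ) - 1) * ((s : ℂ) - 1)) =ᶠ[𝓝[>] 1] fun _ => C := by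
    filter_upwards [self_mem_nhdsWithin] with s hs
    have hs1 : (s : ℂ) - 1 ≠ 0 := by
      rw [sub_ne_zero, Ne, Complex.ofReal_eq_one]
      exact ne_of_gt hs
    field_simp
  exact tendsto_nhds_unique tendsto_const_nhds (hprod.congr' heq)

/-- The Laurent data of `2 ζ(s) L(s, χ)` at `s = 1` for `χ ≠ 1`:
`2 ζ(s) L(s, χ) − 2 L(1, χ)/(s − 1) → 2γ L(1, χ) + 2 L'(1, χ)` as `s → 1⁺`. [folklore] -/
theorem tendsto_two_mul_zeta_mul_LFunction_sub {N : ℕ} [NeZero N] {χ : DirichletCharacter ℂ N}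
    (hχ : χ ≠ 1) :
    Tendsto (fun s : ℝ => 2 * riemannZeta s * χ.LFunction s - 2 * χ.LFunction 1 / ((s : ℂ) - 1))
      (𝓝[>] 1)
      (𝓝 (2 * (Real.eulerMascheroniConstant : ℂ) * χ.LFunction 1 + 2 * deriv χ.LFunction 1)) := by
  -- `ζ(s) − 1/(s−1) → γ`
  have hζ : Tendsto (fun s : ℝ => riemannZeta s - 1 / ((s : ℂ) - 1)) (𝓝[>] 1)
      (𝓝 (Real.eulerMascheroniConstant : ℂ)) :=
    tendsto_riemannZeta_sub_one_div.comp tendsto_ofReal_nhdsGT_one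
  -- `L(s, χ) → L(1, χ)`
  have hdiff : DifferentiableAt ℂ χ.LFunction 1 :=
    DirichletCharacter.differentiableAt_LFunction χ 1 (Or.inr hχ)
  have hL : Tendsto (fun s : ℝ => χ.LFunction s) (𝓝[>] 1) (𝓝 (χ.LFunction 1)) := by
    have hcont : Continuous χ.LFunction := (DirichletCharacter.differentiable_LFunction hχ).continuous
    exact (hcont.tendsto (1 : ℂ)).comp
      ((Complex.continuous_ofReal.tendsto (1 : ℝ)).mono_left (nhdsWithin_le_nhds (s := Set.Ioi 1)))
  -- the difference quotient `(L(s) − L(1))/(s − 1) → L'(1)`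
  have hslope : Tendsto (fun s : ℝ => (χ.LFunction s - χ.LFunction 1) / ((s : ℂ) - 1)) (𝓝[>] 1)
      (𝓝 (deriv χ.LFunction 1)) := by
    have h1 := (hasDerivAt_iff_tendsto_slope.mp hdiff.hasDerivAt).comp tendsto_ofReal_nhdsGT_one
    refine h1.congr fun s => ?_
    simp only [Function.comp_apply, slope_def_field]
  have hall := ((hζ.mul hL).const_mul 2).add (hslope.const_mul 2)
  have hlim : 2 * ((Real.eulerMascheroniConstant : ℂ) * χ.LFunction 1) + 2 * deriv χ.LFunction 1 =
      2 * (Real.eulerMascheroniConstant : ℂ) * χ.LFunction 1 + 2 * deriv χ.LFunction 1 := by ring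
  rw [← hlim]
  refine hall.congr' ?_
  filter_upwards [self_mem_nhdsWithin] with s hs
  have hs1 : (s : ℂ) - 1 ≠ 0 := by
    rw [sub_ne_zero, Ne, Complex.ofReal_eq_one]
    exact ne_of_gt hs
  field_simp
  ring

/-- **Dirichlet's class number formula and Kronecker's `L'(1, χ)`**, from the two expansions of
`Σ_Q Z_Q(s) = 2ζ(s)L(s, χ)` at `s = 1`: with `h = #reducedForms(−d)`, `c = 2π/√d`,
`S = Σ_Q (log(d/a_Q) + 4 log|η(τ_Q)|)`,
`2 L(1, χ) = h c` and `2γ L(1, χ) + 2 L'(1, χ) = c (2γ h − S)`.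
[cite: SelbergChowla1967, §2] -/
theorem LFunction_one_and_deriv_eq {d : ℕ} [NeZero d] {χ : DirichletCharacter ℂ d}
    (hprim : χ.IsPrimitive) (hquad : χ.IsQuadratic) (hodd : χ.Odd) (hd4 : 4 < d) :
    2 * χ.LFunction 1 =
        ((reducedForms (-(d : ℤ))).card : ℂ) * ((2 * π / Real.sqrt d : ℝ) : ℂ) ∧
      2 * (Real.eulerMascheroniConstant : ℂ) * χ.LFunction 1 + 2 * deriv χ.LFunction 1 =
        ((2 * π / Real.sqrt d : ℝ) : ℂ) *
          (2 * Real.eulerMascheroniConstant * ((reducedForms (-(d : ℤ))).card : ℂ) -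
            ((∑ Q ∈ reducedForms (-(d : ℤ)), (Real.log ((d : ℝ) / Q.1) +
              4 * Real.log ‖ModularForm.eta (rootPoint (Q.1 : ℝ) (Q.2.1 : ℝ) (Q.2.2 : ℝ))‖) :
                ℝ) : ℂ)) := by
  have hd : 0 < d := by omega
  have hχ1 : χ ≠ 1 := OddCharLogDeriv.ne_one_of_odd hodd
  set RF := reducedForms (-(d : ℤ)) with hRF
  set c : ℂ := ((2 * π / Real.sqrt d : ℝ) : ℂ) with hc
  set C₁ : ℂ := ∑ Q ∈ RF, ((2 * π / Real.sqrt d *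
      (2 * Real.eulerMascheroniConstant - Real.log ((d : ℝ) / Q.1) -
        4 * Real.log ‖ModularForm.eta (rootPoint (Q.1 : ℝ) (Q.2.1 : ℝ) (Q.2.2 : ℝ))‖) : ℝ) : ℂ)
    with hC₁
  set C₂ : ℂ := 2 * (Real.eulerMascheroniConstant : ℂ) * χ.LFunction 1 + 2 * deriv χ.LFunction 1
    with hC₂
  have T1 : Tendsto (fun s : ℝ => ∑ Q ∈ RF, epsteinZeta (Q.1 : ℝ) (Q.2.1 : ℝ) (Q.2.2 : ℝ) s -
      (RF.card : ℂ) * c / ((s : ℂ) - 1)) (𝓝[>] 1) (𝓝 C₁) := tendsto_sum_epsteinZeta_sub hd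
  have T2 := tendsto_two_mul_zeta_mul_LFunction_sub hχ1
  -- the difference is `(2 L(1) − h c)/(s − 1)` for `s > 1`
  have T3 := T1.sub T2
  have heq : (fun s : ℝ => (∑ Q ∈ RF, epsteinZeta (Q.1 : ℝ) (Q.2.1 : ℝ) (Q.2.2 : ℝ) s -
        (RF.card : ℂ) * c / ((s : ℂ) - 1)) -
      (2 * riemannZeta s * χ.LFunction s - 2 * χ.LFunction 1 / ((s : ℂ) - 1))) =ᶠ[𝓝[>] 1]
      fun s : ℝ => (2 * χ.LFunction 1 - (RF.card : ℂ) * c) / ((s : ℂ) - 1) := by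
    filter_upwards [self_mem_nhdsWithin] with s hs
    have hs' : 1 < ((s : ℂ)).re := by simpa using hs
    rw [sum_epsteinZeta_eq hprim hquad hodd hd4 hs']
    have hs1 : (s : ℂ) - 1 ≠ 0 := by
      rw [sub_ne_zero, Ne, Complex.ofReal_eq_one]
      exact ne_of_gt hs
    field_simp
    ring
  have T4 := T3.congr' heq
  have hzero := eq_zero_of_tendsto_div_sub_one T4
  have hfirst : 2 * χ.LFunction 1 = (RF.card : ℂ) * c := sub_eq_zero.mp hzero
  refine ⟨hfirst, ?_⟩
  -- with the pole gone, the limit of `0` is `C₁ − C₂`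
  have T5 : Tendsto (fun _ : ℝ => (0 : ℂ)) (𝓝[>] 1) (𝓝 (C₁ - C₂)) := by
    refine T4.congr fun s => ?_
    rw [hzero, zero_div]
  have hC : C₁ - C₂ = 0 := (tendsto_nhds_unique T5 tendsto_const_nhds)
  have hC' : C₂ = C₁ := (sub_eq_zero.mp hC).symm
  rw [hC₂] at hC' ⊢
  rw [hC', hC₁, ofReal_sum]
  -- rearrange the finite sum
  have h2γ : 2 * (Real.eulerMascheroniConstant : ℂ) * (RF.card : ℂ) =
      ∑ Q ∈ RF, 2 * (Real.eulerMascheroniConstant : ℂ) := by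
    rw [Finset.sum_const, nsmul_eq_mul, mul_comm]
  rw [h2γ, ← Finset.sum_sub_distrib, Finset.mul_sum]
  refine Finset.sum_congr rfl fun Q _ => ?_
  rw [hc]
  push_cast
  ring


/-! ### The Chowla–Selberg formula -/

/-- **The Chowla–Selberg formula (logarithmic form).** For a primitive quadratic odd Dirichlet
character `χ` mod `d`, `d > 4`, with `h = #reducedForms(−d)` and `τ_Q = (b + i√d)/(2a)`:

  `Σ_{Q=(a,b,c) ∈ reducedForms(−d)} (log(d/a) + 4 log|η(τ_Q)|) = h (Σ_{k<d} χ(k) log Γ(k/d))/L(0, χ) − h log(2π)`.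

Obtained from `LFunction_one_and_deriv_eq` (Kronecker: `L'(1,χ)/L(1,χ) = γ − S/h`), the
functional-equation transfer `OddCharLogDeriv.logDeriv_LFunction_zero_add_one`
(`L'(0)/L(0) + L'(1)/L(1) = γ + log(2π/d)`, `χ⁻¹ = χ`) and Lerch's formula
`Lerch.deriv_LFunction_zero_of_ne_one` (`L'(0)/L(0) = −log d + (Σ χ(k) log Γ(k/d))/L(0, χ)`).
With `L(0, χ) = −(1/d) Σ k χ(k) = 2h/w` this is [SelbergChowla1967, §2 (2)] for fundamental
`−d < −4`. [cite: SelbergChowla1967, §2] -/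
theorem chowlaSelberg_log {d : ℕ} [NeZero d] {χ : DirichletCharacter ℂ d} (hprim : χ.IsPrimitive)
    (hquad : χ.IsQuadratic) (hodd : χ.Odd) (hd4 : 4 < d) :
    ((∑ Q ∈ reducedForms (-(d : ℤ)), (Real.log ((d : ℝ) / Q.1) +
        4 * Real.log ‖ModularForm.eta (rootPoint (Q.1 : ℝ) (Q.2.1 : ℝ) (Q.2.2 : ℝ))‖) : ℝ) : ℂ) =
      ((reducedForms (-(d : ℤ))).card : ℂ) *
          (∑ k ∈ Finset.range d, χ k * (Real.log (Real.Gamma (k / d)) : ℂ)) / χ.LFunction 0 -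
        ((reducedForms (-(d : ℤ))).card : ℂ) * (Real.log (2 * π) : ℂ) := by
  have hd : 0 < d := by omega
  have hdr : (0 : ℝ) < d := by exact_mod_cast hd
  have hχ1 : χ ≠ 1 := OddCharLogDeriv.ne_one_of_odd hodd
  have hL0 : χ.LFunction 0 ≠ 0 := OddCharLogDeriv.LFunction_apply_zero_ne_zero hprim hodd
  have hL1 : χ.LFunction 1 ≠ 0 := DirichletCharacter.LFunction_apply_one_ne_zero hχ1
  obtain ⟨h1, h2⟩ := LFunction_one_and_deriv_eq hprim hquad hodd hd4
  have h3 := OddCharLogDeriv.logDeriv_LFunction_zero_add_one hprim hodd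
  rw [hquad.inv] at h3
  have h4 := Lerch.deriv_LFunction_zero_of_ne_one hχ1
  -- abbreviations
  set h : ℂ := ((reducedForms (-(d : ℤ))).card : ℂ) with hh
  set c : ℂ := ((2 * π / Real.sqrt d : ℝ) : ℂ) with hc
  set S : ℂ := ((∑ Q ∈ reducedForms (-(d : ℤ)), (Real.log ((d : ℝ) / Q.1) +
      4 * Real.log ‖ModularForm.eta (rootPoint (Q.1 : ℝ) (Q.2.1 : ℝ) (Q.2.2 : ℝ))‖) : ℝ) : ℂ)
    with hS
  set G : ℂ := ∑ k ∈ Finset.range d, χ k * (Real.log (Real.Gamma (k / d)) : ℂ) with hG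
  set L0 : ℂ := χ.LFunction 0 with hL0def
  set L1 : ℂ := χ.LFunction 1 with hL1def
  have hc0 : c ≠ 0 := by
    rw [hc, ofReal_ne_zero]
    exact (div_pos Real.two_pi_pos (Real.sqrt_pos.mpr hdr)).ne'
  -- the transfer identity, denominators cleared
  have hA : deriv χ.LFunction 0 * L1 + deriv χ.LFunction 1 * L0 =
      ((Real.eulerMascheroniConstant : ℂ) + (Real.log (2 * π / d) : ℂ)) * L0 * L1 := by
    have h3' := h3
    field_simp at h3'
    linear_combination h3'
  have hlog : (Real.log (2 * π / d) : ℂ) = (Real.log (2 * π) : ℂ) - (Real.log d : ℂ) := by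
    rw [Real.log_div (by positivity) hdr.ne']
    push_cast
    ring
  -- substitute Lerch's `L'(0, χ)` and `log(2π/d) = log 2π − log d`
  rw [hlog, h4] at hA
  -- eliminate `L(1, χ)`, `L'(1, χ)`
  have key : c * (S * L0) = c * (h * G - h * (Real.log (2 * π) : ℂ) * L0) := by
    linear_combination L0 * h2 - 2 * hA -
      (2 * (Real.eulerMascheroniConstant : ℂ) * L0 + (Real.log (2 * π) : ℂ) * L0 - G) * h1
  have key' := mul_left_cancel₀ hc0 key
  field_simp
  linear_combination key'

/-! ### The case `d = 15` -/

/-- The Jacobi character mod `15` is odd. [folklore] -/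
theorem odd_jacobiChar_fifteen : (jacobiChar 15).Odd :=
  jacobiChar_neg_one_of_mod_four_eq_three (by norm_num)

/-- `L(0, χ₋₁₅) = 2` (`= 2h/w`, `h(−15) = 2`, `w = 2`): `−(1/15) Σ_{k<15} k (k/15) = −(−30)/15`.
[folklore] -/
theorem LFunction_jacobiChar_fifteen_zero : (jacobiChar 15).LFunction 0 = 2 := by
  rw [KoblitzOgus.LFunction_apply_zero_of_odd odd_jacobiChar_fifteen]
  have hre := Lerch.sum_univ_zmod_eq_sum_range (N := 15) (fun j a => jacobiChar 15 j * (a : ℂ))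
  rw [hre]
  simp only [Finset.sum_range_succ, Finset.sum_range_zero, jacobiChar_natCast]
  norm_num


/-- **The Chowla–Selberg formula for `d = 15`** (`h = 2`, forms `(1,1,4)`, `(2,1,2)`,
`τ₁ = (1 + i√15)/2`, `τ₂ = (1 + i√15)/4`, `L(0, χ₋₁₅) = 2`):

  `log 15 + 4 log|η(τ₁)| + log(15/2) + 4 log|η(τ₂)|`
  `  = log Γ(1/15) + log Γ(2/15) + log Γ(4/15) − log Γ(7/15) + log Γ(8/15) − log Γ(11/15)`
  `    − log Γ(13/15) − log Γ(14/15) − 2 log(2π)`,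

i.e. `(225/2) |η(τ₁) η(τ₂)|⁴ = Γ(1/15)Γ(2/15)Γ(4/15)Γ(8/15) / (4π² Γ(7/15)Γ(11/15)Γ(13/15)Γ(14/15))` —
the Gamma quotient of `Literature.Analysis.FunctionSpaces.BorweinStraubWanZudilin2012_thm9`.
[cite: SelbergChowla1967, §2] -/
theorem chowlaSelberg_log_fifteen :
    Real.log 15 + 4 * Real.log ‖ModularForm.eta (rootPoint 1 1 4)‖ +
        (Real.log (15 / 2) + 4 * Real.log ‖ModularForm.eta (rootPoint 2 1 2)‖) =
      Real.log (Real.Gamma (1 / 15)) + Real.log (Real.Gamma (2 / 15)) +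
          Real.log (Real.Gamma (4 / 15)) - Real.log (Real.Gamma (7 / 15)) +
          Real.log (Real.Gamma (8 / 15)) - Real.log (Real.Gamma (11 / 15)) -
          Real.log (Real.Gamma (13 / 15)) - Real.log (Real.Gamma (14 / 15)) -
        2 * Real.log (2 * π) := by
  have hsq : Squarefree 15 := by
    rw [show (15 : ℕ) = 3 * 5 by norm_num, Nat.squarefree_mul (by norm_num)]
    exact ⟨Nat.prime_three.squarefree, Nat.prime_five.squarefree⟩
  have hprim : (jacobiChar 15).IsPrimitive := isPrimitive_jacobiChar (by decide) hsq
  have h := chowlaSelberg_log hprim isQuadratic_jacobiChar odd_jacobiChar_fifteen (by norm_num)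
  rw [show (-((15 : ℕ) : ℤ)) = -15 by norm_num, reducedForms_neg_fifteen,
    LFunction_jacobiChar_fifteen_zero, Finset.sum_insert (by decide), Finset.sum_singleton,
    Finset.card_insert_of_notMem (by decide), Finset.card_singleton] at h
  simp only [Finset.sum_range_succ, Finset.sum_range_zero, jacobiChar_natCast, Nat.cast_ofNat,
    Nat.cast_one, CharP.cast_eq_zero, Int.cast_one, Int.cast_ofNat] at h
  norm_num [-Complex.natCast_log, -Complex.ofNat_log] at h
  apply Complex.ofReal_injective
  push_cast
  linear_combination h


/-- `rootPoint a b c` lies in the upper half plane for a positive definite form. [folklore] -/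
theorem rootPoint_mem_upperHalfPlaneSet {a b c : ℝ} (h : IsPosDefForm a b c) :
    rootPoint a b c ∈ UpperHalfPlane.upperHalfPlaneSet := by
  show 0 < (rootPoint a b c).im
  rw [KroneckerLimit.rootPoint_im]
  unfold Literature.Barriers.RiemannHypothesis.starkK
  have ha := h.a_pos
  have hD : 0 < 4 * a * c - b ^ 2 := by linarith [h.disc_neg]
  exact div_pos (Real.sqrt_pos.mpr hD) (by linarith)

/-- **The Chowla–Selberg formula for `d = 15`, product form**: with `τ₁ = (1 + i√15)/2`,
`τ₂ = (1 + i√15)/4`,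

  `Γ(1/15)Γ(2/15)Γ(4/15)Γ(8/15) / (Γ(7/15)Γ(11/15)Γ(13/15)Γ(14/15)) = 450 π² |η(τ₁)|⁴ |η(τ₂)|⁴`

— the Gamma quotient under the square root of
`Literature.Analysis.FunctionSpaces.BorweinStraubWanZudilin2012_thm9`. [cite: SelbergChowla1967, §2] -/
theorem chowlaSelberg_fifteen_prod :
    Real.Gamma (1 / 15) * Real.Gamma (2 / 15) * Real.Gamma (4 / 15) * Real.Gamma (8 / 15) /
        (Real.Gamma (7 / 15) * Real.Gamma (11 / 15) * Real.Gamma (13 / 15) * Real.Gamma (14 / 15)) =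
      450 * π ^ 2 * ‖ModularForm.eta (rootPoint 1 1 4)‖ ^ 4 *
        ‖ModularForm.eta (rootPoint 2 1 2)‖ ^ 4 := by
  have h := chowlaSelberg_log_fifteen
  have hη1 : 0 < ‖ModularForm.eta (rootPoint 1 1 4)‖ :=
    norm_pos_iff.mpr (ModularForm.eta_ne_zero
      (rootPoint_mem_upperHalfPlaneSet ⟨by norm_num, by norm_num⟩))
  have hη2 : 0 < ‖ModularForm.eta (rootPoint 2 1 2)‖ :=
    norm_pos_iff.mpr (ModularForm.eta_ne_zero
      (rootPoint_mem_upperHalfPlaneSet ⟨by norm_num, by norm_num⟩))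
  have hΓ : ∀ x : ℝ, 0 < x → 0 < Real.Gamma x := fun x hx => Real.Gamma_pos_of_pos hx
  have h1 := hΓ (1 / 15) (by norm_num)
  have h2 := hΓ (2 / 15) (by norm_num)
  have h4 := hΓ (4 / 15) (by norm_num)
  have h7 := hΓ (7 / 15) (by norm_num)
  have h8 := hΓ (8 / 15) (by norm_num)
  have h11 := hΓ (11 / 15) (by norm_num)
  have h13 := hΓ (13 / 15) (by norm_num)
  have h14 := hΓ (14 / 15) (by norm_num)
  -- compare logarithms
  have hL : 0 < Real.Gamma (1 / 15) * Real.Gamma (2 / 15) * Real.Gamma (4 / 15) *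
      Real.Gamma (8 / 15) / (Real.Gamma (7 / 15) * Real.Gamma (11 / 15) * Real.Gamma (13 / 15) *
        Real.Gamma (14 / 15)) := by positivity
  have hR : 0 < 450 * π ^ 2 * ‖ModularForm.eta (rootPoint 1 1 4)‖ ^ 4 *
      ‖ModularForm.eta (rootPoint 2 1 2)‖ ^ 4 := by positivity
  refine Real.log_injOn_pos hL hR ?_
  rw [Real.log_div (by positivity) (by positivity), Real.log_mul (by positivity) (by positivity),
    Real.log_mul (by positivity) (by positivity), Real.log_mul (by positivity) (by positivity),
    Real.log_mul (by positivity) (by positivity), Real.log_mul (by positivity) (by positivity),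
    Real.log_mul (by positivity) (by positivity)]
  rw [Real.log_mul (by positivity) (by positivity), Real.log_mul (by positivity) (by positivity),
    Real.log_mul (by positivity) (by positivity), Real.log_pow, Real.log_pow, Real.log_pow]
  have h450 : Real.log 450 = Real.log 15 + Real.log (15 / 2) + 2 * Real.log 2 := by
    rw [show (450 : ℝ) = 15 * (15 / 2) * 2 ^ 2 by norm_num, Real.log_mul (by norm_num) (by norm_num),
      Real.log_mul (by norm_num) (by norm_num), Real.log_pow]
    push_cast
    ring
  have h2π : Real.log (2 * π) = Real.log 2 + Real.log π :=
    Real.log_mul (by norm_num) Real.pi_ne_zero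
  rw [h450]
  rw [h2π] at h
  push_cast
  linarith

end Literature.NumberTheory.QuadraticFields.ChowlaSelberg

end
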